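import Literature.MathematicalPhysics.QuantumManyBody.YukawaSubordination
import HarnessLib

/-!
# Gaussian charge clouds: Coulomb interaction, self-energy scale, domination

Topic `Literature/MathematicalPhysics/QuantumManyBody` (electrostatics groundwork for the charged
Bose gas, `JelliumBoseGas.foldyLaw`): the ingredients of Onsager's electrostatic inequality
[LiebLoss2001, Thm. 9.8 ff.; LiebNarnhofer1975] with GAUSSIAN smearing — unit charges are
replaced by heat-kernel clouds `G_t(· - xᵢ)` (`G_t` = `Literature.Analysis.UnboundedOperators.heatKernel`
on `ℝ³`, a probability density), whose electrostatics is explicit by subordination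
(`(4π|z|)⁻¹ = ∫₀^∞ G_s(z) ds`, `BoseGas.integral_Ioi_heatKernel`) and the semigroup law
(`heatKernel_convolution_heatKernel_holds`):

* `integral_heatKernel_mul_heatKernel_sub` and translated forms — `∫ G_s(y)G_t(z-y)dy = G_{s+t}(z)`
  pointwise; `integrable_heatKernel_sub_mul_heatKernel_sub('')`.
* `lintegral_heatKernel_mul_coulomb` — the potential of a cloud, `∫ G_t(y-b)(4π|x-y|)⁻¹dy
  = ∫₀^∞ G_{r+t}(x-b) dr`;
* `lintegral_gaussian_gaussian_coulomb` — **`∬ G_s(x-a)G_t(y-b)(4π|x-y|)⁻¹ = ∫_{s+t}^∞ G_u(a-b)du`**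
  (all in `ℝ≥0∞`, Tonelli): the interaction of two clouds is the Coulomb kernel with the times
  `u < s+t` removed;
* `integral_Ioi_heatKernel_zero` / `lintegral_Ioi_heatKernel_zero` — the self-energy scale
  **`∫_τ^∞ G_u(0) du = 1/(4π√(πτ))`**;
* `lintegral_Ioi_heatKernel_le_coulomb` (`∫_τ^∞ G_u(z)du ≤ (4π|z|)⁻¹`: the cloud–cloud interaction
  is at most the point-charge interaction) and `lintegral_Ioi_heatKernel_le_self` (it is at most
  the self-energy scale, `G_u(z) ≤ G_u(0)`).

What is NOT here (next step): the Onsager inequality itself, `∑_{i<j}|xᵢ-xⱼ|⁻¹ ≥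
∑ᵢ (V_b ⋆ G_t)(xᵢ) − ½⟨ρ_b, ρ_b⟩ − N/(2√(2πt))` from `Coulomb.coulombEnergy_nonneg` applied to
`∑ᵢ G_t(· - xᵢ) − ρ_b`.

## References

* [LiebLoss2001] E. H. Lieb, M. Loss, *Analysis*, 2nd ed. (2001), Thm. 9.8 and §9.
* [LiebNarnhofer1975] E. H. Lieb, H. Narnhofer, J. Stat. Phys. 12 (1975) 291–310 (jellium
  electrostatics).
* [Evans2010] L. C. Evans, *Partial Differential Equations*, 2nd ed., §2.3.1 (heat kernel semigroup).
-/

noncomputable section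

open MeasureTheory Set Filter Real
open scoped ENNReal NNReal Topology Convolution
open Literature.Analysis.UnboundedOperators

namespace Literature.MathematicalPhysics.QuantumManyBody.Coulomb

open BoseGas

/-! ### Elementary facts on the heat kernel of `ℝ³` -/

/-- The heat kernel is even. [folklore] -/
theorem heatKernel_neg (t : ℝ) (x : Space) : heatKernel t (-x) = heatKernel t x := by
  unfold heatKernel
  rw [norm_neg]

/-- **Semigroup law, pointwise**: `∫ G_s(y) G_t(z - y) dy = G_{s+t}(z)` (`0 < s, t`).
[cite: Evans2010, §2.3.1] -/
theorem integral_heatKernel_mul_heatKernel_sub {s t : ℝ} (hs : 0 < s) (ht : 0 < t) (z : Space) :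
    ∫ y : Space, heatKernel s y * heatKernel t (z - y) = heatKernel (s + t) z := by
  have h := congrFun (heatKernel_convolution_heatKernel_holds (E := Space) hs ht) z
  rw [convolution_def] at h
  simpa only [ContinuousLinearMap.lsmul_apply, smul_eq_mul] using h

/-- Translated form: `∫ G_r(x - y) G_t(y - b) dy = G_{r+t}(x - b)`. [folklore] -/
theorem integral_heatKernel_sub_mul_heatKernel_sub {r t : ℝ} (hr : 0 < r) (ht : 0 < t)
    (x b : Space) :
    ∫ y : Space, heatKernel r (x - y) * heatKernel t (y - b) = heatKernel (r + t) (x - b) := by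
  have h1 : ∫ y : Space, heatKernel r (x - y) * heatKernel t (y - b) =
      ∫ y : Space, heatKernel t (y - b) * heatKernel r ((x - b) - (y - b)) := by
    refine integral_congr_ae (Eventually.of_forall fun y => ?_)
    simp only [sub_sub_sub_cancel_right]
    ring
  rw [h1, integral_sub_right_eq_self (μ := (volume : Measure Space))
    (fun y' : Space => heatKernel t y' * heatKernel r ((x - b) - y')) b,
    integral_heatKernel_mul_heatKernel_sub ht hr, add_comm]

/-- Second translated form: `∫ G_s(x - a) G_u(x - b) dx = G_{s+u}(a - b)`. [folklore] -/
theorem integral_heatKernel_sub_mul_heatKernel_sub' {s u : ℝ} (hs : 0 < s) (hu : 0 < u)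
    (a b : Space) :
    ∫ x : Space, heatKernel s (x - a) * heatKernel u (x - b) = heatKernel (s + u) (a - b) := by
  have h1 : ∫ x : Space, heatKernel s (x - a) * heatKernel u (x - b) =
      ∫ x : Space, heatKernel s (x - a) * heatKernel u ((b - a) - (x - a)) := by
    refine integral_congr_ae (Eventually.of_forall fun x => ?_)
    simp only
    rw [show (b - a) - (x - a) = -(x - b) by abel, heatKernel_neg]
  rw [h1, integral_sub_right_eq_self (μ := (volume : Measure Space))
    (fun x' : Space => heatKernel s x' * heatKernel u ((b - a) - x')) a,
    integral_heatKernel_mul_heatKernel_sub hs hu, ← heatKernel_neg, neg_sub]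

/-- The heat kernel is bounded by its value scale `(4πt)^{-3/2}` (in `ℝ³`). [folklore] -/
theorem heatKernel_le_three {t : ℝ} (ht : 0 < t) (x : Space) :
    heatKernel t x ≤ (4 * π * t) ^ (-(3 : ℝ) / 2) := by
  have h := heatKernel_le ht x
  rw [finrank_euclideanSpace_fin] at h
  exact_mod_cast h

/-- `y ↦ G_r(x - y) G_t(y - b)` is integrable (bounded times integrable). [folklore] -/
theorem integrable_heatKernel_sub_mul_heatKernel_sub {r t : ℝ} (hr : 0 < r) (ht : 0 < t)
    (x b : Space) : Integrable fun y : Space => heatKernel r (x - y) * heatKernel t (y - b) := by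
  have hi : Integrable fun y : Space => heatKernel t (y - b) :=
    (integrable_heatKernel_holds (E := Space) ht).comp_sub_right b
  refine (hi.bdd_mul (c := (4 * π * r) ^ (-(3 : ℝ) / 2)) ?_ (Eventually.of_forall fun y => ?_))
  · exact ((continuous_heatKernel r).comp
      (by fun_prop : Continuous fun y : Space => x - y)).aestronglyMeasurable
  · rw [Real.norm_of_nonneg (heatKernel_pos hr _).le]
    exact heatKernel_le_three hr _

/-- `x ↦ G_s(x - a) G_u(x - b)` is integrable. [folklore] -/
theorem integrable_heatKernel_sub_mul_heatKernel_sub' {s u : ℝ} (hs : 0 < s) (hu : 0 < u)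
    (a b : Space) : Integrable fun x : Space => heatKernel s (x - a) * heatKernel u (x - b) := by
  have hi : Integrable fun x : Space => heatKernel s (x - a) :=
    (integrable_heatKernel_holds (E := Space) hs).comp_sub_right a
  have h : Integrable fun x : Space => heatKernel u (x - b) * heatKernel s (x - a) := by
    refine hi.bdd_mul (c := (4 * π * u) ^ (-(3 : ℝ) / 2)) ?_ (Eventually.of_forall fun x => ?_)
    · exact ((continuous_heatKernel u).comp
        (by fun_prop : Continuous fun x : Space => x - b)).aestronglyMeasurable
    · rw [Real.norm_of_nonneg (heatKernel_pos hu _).le]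
      exact heatKernel_le_three hu _
  exact h.congr (Eventually.of_forall fun x => mul_comm _ _)

/-- Shift of the subordination variable: `∫⁻_{r>0} f(r + c) dr = ∫⁻_{u>c} f(u) du`. [folklore] -/
theorem lintegral_Ioi_comp_add_right (f : ℝ → ℝ≥0∞) (c : ℝ) :
    ∫⁻ r in Ioi (0 : ℝ), f (r + c) = ∫⁻ u in Ioi c, f u := by
  rw [← lintegral_indicator measurableSet_Ioi, ← lintegral_indicator measurableSet_Ioi]
  have h : (fun r : ℝ => (Ioi (0 : ℝ)).indicator (fun r => f (r + c)) r) =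
      fun r => (Ioi c).indicator f (r + c) := by
    funext r
    by_cases hr : r ∈ Ioi (0 : ℝ)
    · rw [indicator_of_mem hr, indicator_of_mem (show r + c ∈ Ioi c by
        simp only [mem_Ioi] at hr ⊢; linarith)]
    · rw [indicator_of_notMem hr, indicator_of_notMem (show r + c ∉ Ioi c by
        simp only [mem_Ioi, not_lt] at hr ⊢; linarith)]
  rw [h]
  exact lintegral_add_right_eq_self (μ := (volume : Measure ℝ)) (fun u => (Ioi c).indicator f u) c

/-! ### The Coulomb interaction of two Gaussian clouds -/

/-- Inner integral: `∫⁻ G_t(y - b) (4π|x - y|)⁻¹ dy = ∫⁻_{r>0} G_{r+t}(x - b) dr` — the potential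
of the cloud `G_t(· - b)` at `x`, subordinated. [folklore] -/
theorem lintegral_heatKernel_mul_coulomb {t : ℝ} (ht : 0 < t) (x b : Space) :
    ∫⁻ y : Space, ENNReal.ofReal (heatKernel t (y - b)) * ENNReal.ofReal ((4 * π * ‖x - y‖)⁻¹) =
      ∫⁻ r in Ioi (0 : ℝ), ENNReal.ofReal (heatKernel (r + t) (x - b)) := by
  -- subordination of the Coulomb kernel, off `y = x`
  have hae : ∀ᵐ y : Space ∂volume, y ≠ x := by
    have : (volume : Measure Space) {y | ¬y ≠ x} = 0 := by
      simp only [ne_eq, not_not, setOf_eq_eq_singleton, measure_singleton]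
    exact ae_iff.2 this
  have step1 : ∫⁻ y : Space, ENNReal.ofReal (heatKernel t (y - b)) * ENNReal.ofReal ((4 * π * ‖x - y‖)⁻¹) =
      ∫⁻ y : Space, ∫⁻ r in Ioi (0 : ℝ),
        ENNReal.ofReal (heatKernel r (x - y) * heatKernel t (y - b)) := by
    refine lintegral_congr_ae ?_
    filter_upwards [hae] with y hy
    have hxy : x - y ≠ 0 := sub_ne_zero.2 (Ne.symm hy)
    rw [← lintegral_Ioi_heatKernel hxy, ← lintegral_const_mul' _ _ ENNReal.ofReal_ne_top]
    refine lintegral_congr fun r => ?_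
    rw [← ENNReal.ofReal_mul (heatKernel_pos ht _).le, mul_comm]
  have hmeas : Measurable fun q : Space × ℝ =>
      ENNReal.ofReal (heatKernel q.2 (x - q.1) * heatKernel t (q.1 - b)) := by
    refine ENNReal.measurable_ofReal.comp ?_
    exact (measurable_heatKernel_uncurry.comp (measurable_snd.prodMk (measurable_const.sub measurable_fst))).mul
      ((continuous_heatKernel t).measurable.comp (measurable_fst.sub measurable_const))
  rw [step1, lintegral_lintegral_swap hmeas.aemeasurable]
  refine setLIntegral_congr_fun measurableSet_Ioi fun r hr => ?_
  have hr0 : (0 : ℝ) < r := hr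
  rw [← ofReal_integral_eq_lintegral_ofReal (integrable_heatKernel_sub_mul_heatKernel_sub hr0 ht x b)
    (Eventually.of_forall fun y => mul_nonneg (heatKernel_pos hr0 _).le (heatKernel_pos ht _).le),
    integral_heatKernel_sub_mul_heatKernel_sub hr0 ht]

/-- **The Coulomb interaction of two Gaussian clouds** (`ℝ≥0∞` form): for `0 < s, t` and centres
`a, b ∈ ℝ³`, `∬ G_s(x - a) G_t(y - b) (4π|x - y|)⁻¹ dx dy = ∫_{s+t}^∞ G_u(a - b) du` — by
subordination of the Coulomb kernel and the semigroup law, the interaction of the clouds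
`G_s(· - a)`, `G_t(· - b)` is the Coulomb kernel with the times `u < s + t` removed. [folklore] -/
theorem lintegral_gaussian_gaussian_coulomb {s t : ℝ} (hs : 0 < s) (ht : 0 < t) (a b : Space) :
    ∫⁻ x : Space, ∫⁻ y : Space, ENNReal.ofReal (heatKernel s (x - a)) *
        (ENNReal.ofReal (heatKernel t (y - b)) * ENNReal.ofReal ((4 * π * ‖x - y‖)⁻¹)) =
      ∫⁻ u in Ioi (s + t), ENNReal.ofReal (heatKernel u (a - b)) := by
  have hmx : ∀ x : Space, Measurable fun y : Space =>
      ENNReal.ofReal (heatKernel t (y - b)) * ENNReal.ofReal ((4 * π * ‖x - y‖)⁻¹) := fun x =>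
    (ENNReal.measurable_ofReal.comp ((continuous_heatKernel t).measurable.comp
      (measurable_id.sub measurable_const))).mul (ENNReal.measurable_ofReal.comp
      ((measurable_const.mul (measurable_const.sub measurable_id).norm).inv))
  simp_rw [lintegral_const_mul _ (hmx _), lintegral_heatKernel_mul_coulomb ht]
  -- swap `x` and `r`, evaluate the `x`-integral by the semigroup law
  have hmeas : Measurable fun q : Space × ℝ =>
      ENNReal.ofReal (heatKernel s (q.1 - a)) * ENNReal.ofReal (heatKernel (q.2 + t) (q.1 - b)) :=
    (ENNReal.measurable_ofReal.comp ((continuous_heatKernel s).measurable.comp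
      (measurable_fst.sub measurable_const))).mul (ENNReal.measurable_ofReal.comp
      (measurable_heatKernel_uncurry.comp ((measurable_snd.add measurable_const).prodMk
        (measurable_fst.sub measurable_const))))
  have step2 : ∫⁻ x : Space, ENNReal.ofReal (heatKernel s (x - a)) *
      ∫⁻ r in Ioi (0 : ℝ), ENNReal.ofReal (heatKernel (r + t) (x - b)) =
      ∫⁻ r in Ioi (0 : ℝ), ∫⁻ x : Space,
        ENNReal.ofReal (heatKernel s (x - a)) * ENNReal.ofReal (heatKernel (r + t) (x - b)) := by
    simp_rw [← lintegral_const_mul' _ _ ENNReal.ofReal_ne_top]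
    exact lintegral_lintegral_swap hmeas.aemeasurable
  rw [step2]
  have step3 : ∀ r ∈ Ioi (0 : ℝ), ∫⁻ x : Space,
      ENNReal.ofReal (heatKernel s (x - a)) * ENNReal.ofReal (heatKernel (r + t) (x - b)) =
      ENNReal.ofReal (heatKernel (r + (s + t)) (a - b)) := by
    intro r hr
    have hr0 : (0 : ℝ) < r := hr
    have hrt : 0 < r + t := by linarith
    simp_rw [← ENNReal.ofReal_mul (heatKernel_pos hs _).le]
    rw [← ofReal_integral_eq_lintegral_ofReal (integrable_heatKernel_sub_mul_heatKernel_sub' hs hrt a b)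
      (Eventually.of_forall fun x => mul_nonneg (heatKernel_pos hs _).le (heatKernel_pos hrt _).le),
      integral_heatKernel_sub_mul_heatKernel_sub' hs hrt, show s + (r + t) = r + (s + t) by ring]
  rw [setLIntegral_congr_fun measurableSet_Ioi step3]
  exact lintegral_Ioi_comp_add_right (fun u => ENNReal.ofReal (heatKernel u (a - b))) (s + t)

/-! ### Self-energy scale and domination by the point charge -/

/-- The heat kernel at the origin: `G_u(0) = (4πu)^{-3/2}`. [folklore] -/
theorem heatKernel_zero_eq (u : ℝ) : heatKernel u (0 : Space) = (4 * π * u) ^ (-(3 / 2 : ℝ)) := by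
  rw [heatKernel_three, norm_zero]
  simp

/-- The heat kernel is maximal at the origin: `G_u(z) ≤ G_u(0)` (`u > 0`). [folklore] -/
theorem heatKernel_le_heatKernel_zero {u : ℝ} (hu : 0 < u) (z : Space) :
    heatKernel u z ≤ heatKernel u (0 : Space) := by
  rw [heatKernel_three, heatKernel_three, norm_zero]
  have h1 : Real.exp (-‖z‖ ^ 2 / (4 * u)) ≤ 1 :=
    Real.exp_le_one_iff.2 (div_nonpos_of_nonpos_of_nonneg (neg_nonpos.2 (sq_nonneg _)) (by positivity))
  have h2 : 0 ≤ (4 * π * u) ^ (-(3 / 2 : ℝ)) := by positivity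
  calc (4 * π * u) ^ (-(3 / 2 : ℝ)) * Real.exp (-‖z‖ ^ 2 / (4 * u))
      ≤ (4 * π * u) ^ (-(3 / 2 : ℝ)) * 1 := mul_le_mul_of_nonneg_left h1 h2
    _ = _ := by simp

/-- **The self-energy scale**: `∫_τ^∞ G_u(0) du = 1/(4π√(πτ))` for `τ > 0` (half the Coulomb
self-energy `∬ G G/(4π|x-y|)` of the cloud `G_{τ/2}`, by `lintegral_gaussian_gaussian_coulomb`);
`s ↦ G_s(0)` is integrable on `(τ, ∞)`. [folklore] -/
theorem integral_Ioi_heatKernel_zero {τ : ℝ} (hτ : 0 < τ) :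
    IntegrableOn (fun u : ℝ => heatKernel u (0 : Space)) (Ioi τ) ∧
      ∫ u in Ioi τ, heatKernel u (0 : Space) = (4 * π * Real.sqrt (π * τ))⁻¹ := by
  have hlt : (-(3 / 2 : ℝ)) < -1 := by norm_num
  have e : ∀ u ∈ Ioi τ, heatKernel u (0 : Space) = (4 * π) ^ (-(3 / 2 : ℝ)) * u ^ (-(3 / 2 : ℝ)) := by
    intro u hu
    have hu0 : 0 < u := hτ.trans hu
    rw [heatKernel_zero_eq, Real.mul_rpow (by positivity) hu0.le]
  refine ⟨?_, ?_⟩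
  · have h1 : IntegrableOn (fun u : ℝ => (4 * π) ^ (-(3 / 2 : ℝ)) * u ^ (-(3 / 2 : ℝ))) (Ioi τ) :=
      (integrableOn_Ioi_rpow_of_lt hlt hτ).const_mul _
    exact h1.congr_fun (fun u hu => (e u hu).symm) measurableSet_Ioi
  · rw [setIntegral_congr_fun measurableSet_Ioi e, integral_const_mul, integral_Ioi_rpow_of_lt hlt hτ]
    -- `(4π)^{-3/2} · (−τ^{-1/2}/(−1/2)) = 1/(4π√(πτ))`
    have hπ : 0 < π := Real.pi_pos
    have e3 : (4 * π) ^ (-(3 / 2 : ℝ)) = (4 * π * (2 * Real.sqrt π))⁻¹ := by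
      rw [Real.rpow_neg (by positivity), show (3 / 2 : ℝ) = 1 + 1 / 2 by norm_num,
        Real.rpow_add (by positivity), Real.rpow_one, ← Real.sqrt_eq_rpow, Real.sqrt_mul' _ hπ.le,
        show Real.sqrt 4 = 2 by rw [show (4:ℝ) = 2 ^ 2 by norm_num, Real.sqrt_sq (by norm_num)]]
    have e4 : τ ^ (-(3 / 2 : ℝ) + 1) = (Real.sqrt τ)⁻¹ := by
      rw [show (-(3 / 2 : ℝ) + 1) = -(1 / 2) by norm_num, Real.rpow_neg hτ.le, ← Real.sqrt_eq_rpow]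
    have hsπ : 0 < Real.sqrt π := Real.sqrt_pos.2 hπ
    have hsτ : 0 < Real.sqrt τ := Real.sqrt_pos.2 hτ
    rw [e3, e4, Real.sqrt_mul' _ hτ.le]
    field_simp
    norm_num

/-- `ℝ≥0∞` form of the self-energy scale. [folklore] -/
theorem lintegral_Ioi_heatKernel_zero {τ : ℝ} (hτ : 0 < τ) :
    ∫⁻ u in Ioi τ, ENNReal.ofReal (heatKernel u (0 : Space)) =
      ENNReal.ofReal ((4 * π * Real.sqrt (π * τ))⁻¹) := by
  obtain ⟨hint, hval⟩ := integral_Ioi_heatKernel_zero hτ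
  rw [← hval, ofReal_integral_eq_lintegral_ofReal hint]
  refine (ae_restrict_iff' measurableSet_Ioi).2 (Eventually.of_forall fun u hu => ?_)
  exact (heatKernel_pos (hτ.trans hu) _).le

/-- **The interaction of two clouds is at most the point-charge interaction**:
`∫_τ^∞ G_u(z) du ≤ (4π|z|)⁻¹` for `τ ≥ 0`, `z ≠ 0` (drop the times `u < τ`). [folklore] -/
theorem lintegral_Ioi_heatKernel_le_coulomb {τ : ℝ} (hτ : 0 ≤ τ) {z : Space} (hz : z ≠ 0) :
    ∫⁻ u in Ioi τ, ENNReal.ofReal (heatKernel u z) ≤ ENNReal.ofReal ((4 * π * ‖z‖)⁻¹) := by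
  rw [← lintegral_Ioi_heatKernel hz]
  exact lintegral_mono_set (Ioi_subset_Ioi hτ)

/-- **The interaction of two clouds is at most the self-energy scale**:
`∫_τ^∞ G_u(z) du ≤ ∫_τ^∞ G_u(0) du = 1/(4π√(πτ))` for `τ > 0` and every `z`. [folklore] -/
theorem lintegral_Ioi_heatKernel_le_self {τ : ℝ} (hτ : 0 < τ) (z : Space) :
    ∫⁻ u in Ioi τ, ENNReal.ofReal (heatKernel u z) ≤ ENNReal.ofReal ((4 * π * Real.sqrt (π * τ))⁻¹) := by
  rw [← lintegral_Ioi_heatKernel_zero hτ]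
  refine setLIntegral_mono' measurableSet_Ioi fun u hu => ?_
  exact ENNReal.ofReal_le_ofReal (heatKernel_le_heatKernel_zero (hτ.trans hu) z)

end Literature.MathematicalPhysics.QuantumManyBody.Coulomb
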